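import Literature.MathematicalPhysics.QuantumFieldTheory.Balaban1983to89.B9SectBCodedChainGlob

/-!
# `Balaban1983to89.B9SectBCodedChainAn` — the analytic-extension member of the coded-carrier chain: the coded analyticity predicate (tautological at the
# letters), the frame `AnFrame₂` over the coded carrier INHABITED, the record pin it transports to, and `hAn` DISCHARGED for that pin

T. Bałaban, *Propagators for lattice gauge theories in a background field*, Commun. Math. Phys. **99** (1985) 389–434
[`Balaban1985BackgroundPropagators`, "B9"], Theorem 3.4 p. 400 («the operators G′(U), … extend to configurations U′U for α₁ ≦ a₁ as analytic functions of
A′»), (3.62)–(3.64) p. 402, (3.35)–(3.37) p. 396; T. Bałaban, *Propagators and renormalization transformations for lattice gauge theories. II*, Commun. Math.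
Phys. **96** (1984) 223–250 [`Balaban1984PropagatorsII`, "[4]"], (2.45) p. 231.

statement-level skeleton of published theorems with citation tags; proofs where landed; nothing here is a claim about the Yang–Mills mass gap

WHY THIS FILE (pub-ymgap N06 row 13, seat dag-n06-c gen 8; item (O6) of the chain).  The family transfer `B9SectBStepFamilyTransfer.sectBStepPrinted_of_family`
displays `hAn`: the coded side's analyticity predicate must transport to the record's along the decoding.  The letters-level frame `AnFrame₂.writeAn` WRITES the
coded predicate at a regular base from the two-sided inverse identities `Δ′(U′U)·G′(U′U) = 1 = G′(U′U)·Δ′(U′U)` (conj-`b` letters) for every `U′` of the class —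
print's content of (3.62)–(3.64).  THIS FILE (i) DEFINES the coded predicate `IsAnKY` as exactly that statement (kernel-family independent; tautological for
`writeAn`, as `KSC`'s (3.42) member is for `write342`), so ★ `anFrame₂CodedOn` INHABITS `AnFrame₂` over the coded carriers of every subfamily with sections (the
THIRD frame after the root and (3.47)); (ii) DEFINES the record-side predicate `IsAnRecY r` («for every code `a` of the class at exponent `r·β`, `η²G′(e^{ηa}U)` is
the two-sided inverse of `η⁻²Δ′_a(e^{ηa}U)` in coordinates») and PROVES `hAn` for the pair `(IsAnKY, IsAnRecY r)` (`pullAn` at a base, `pullAn_base_iff`); (iii)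
composes the chain with `hAn` DISCHARGED: ★★★ `sectBStepPrinted_on_of_KSC₂_C37Y_an` ∕ `…cornerFree…` — the displayed hypotheses are now the frames' output
`h` and structural record data ONLY; (iv) reads the pin back in NODE 00's vocabulary: `isUnit_deltaPrimeAY_of_isAnRecY` (`Δ′_a(U′U)` is a unit).  Whether the
certificate pins `(𝔈 x).IsAnalyticExt := IsAnRecY …` is the instance owner's ∕ certificate's decision (a `hpinAn`-type binder, like `hpinE`); this file makes
the consequence available.

WHAT IS IN THE FILE (0 sorry; standard axioms; `def`s = the two predicates and the frame).
* §1 `IsAnKY`, `IsAnRecY`, `isAnKY_base_iff`, ★ `hAn_of_pin` (the `hAn` hypothesis, both conjuncts, every kernel family).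
* §2 ★ `anFrame₂CodedOn` (generic coded family `KC` with the root dictionaries displayed, as `gpFrame₂CodedOn`).
* §3 ★★★ `sectBStepPrinted_on_of_KSC₂_C37Y_an`, ★★★ `sectBStepPrinted_cornerFree_of_KSC₂_C37Y_an`.
* §4 `isUnit_deltaPrimeAY_of_isAnRecY` (the pin in NODE 00's vocabulary).

HONEST SCOPE.  Bookkeeping: the analytic content of the extension (Neumann series (3.62)–(3.64)) is r06's `thm34_Gp_uniform`, consumed by the abstract step
`stepAnalyticPos1_of_anFrame₂`, not here; this file names the predicates so that the frame is inhabited and the transport is the identity.  Nothing of Theorem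
3.4 asserted; N06 NOT discharged; COUNT-NEUTRAL; one finite lattice programme — nothing continuum ∕ OS ∕ mass-gap ∕ Clay.  Cell `pub-ymgap` (HUMAN RULING
D-0062), Track A node N06 [B9], row 13, 2026-08-28.
-/

namespace Literature.MathematicalPhysics.QuantumFieldTheory.Balaban1983to89.B9SectBCodedChainAn

open Literature.MathematicalPhysics.QuantumFieldTheory.Balaban1983to89
open Literature.MathematicalPhysics.QuantumFieldTheory.Balaban1983to89.B6KLevelCensusIndexV1 (KIdx kGeo)
open Literature.MathematicalPhysics.QuantumFieldTheory.Balaban1983to89.B6Ineq2142KLevelV1 (β)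
open Literature.MathematicalPhysics.QuantumFieldTheory.Balaban1983to89.B9FromB6 (EBlock GlobBlock)
open Literature.MathematicalPhysics.QuantumFieldTheory.Balaban1983to89.B9Eq39Adjoint (fluct)
open Literature.MathematicalPhysics.QuantumFieldTheory.Balaban1983to89.B9Eq352DivFormLetters (conj)
open Literature.MathematicalPhysics.QuantumFieldTheory.Balaban1983to89.B9SectBCodedCarrier (CCfg Coding pullK pullS pullAn pullAn_base_iff pullK_injective)
open Literature.MathematicalPhysics.QuantumFieldTheory.Balaban1983to89.B9SectBGpStepAtLettersV2 (GpFrame₂ AnFrame₂)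
open Literature.MathematicalPhysics.QuantumFieldTheory.Balaban1983to89.B9Eq360DeltaPrimeAY (AfldY mulY)
open Literature.MathematicalPhysics.QuantumFieldTheory.Balaban1983to89.B9PinMembersKLevelV1 (MemberY geo9Y bg9Y)
open Literature.MathematicalPhysics.QuantumFieldTheory.Balaban1983to89.B9SectBGpLettersY
open Literature.MathematicalPhysics.QuantumFieldTheory.Balaban1983to89.B9SectBGpFrameCodedY (codingYx CplxLettersY Read342Y Write342Y)
open Literature.MathematicalPhysics.QuantumFieldTheory.Balaban1983to89.B9SectBCodedClassY (C37Y cplxLettersY_of_C37Y)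
open Literature.MathematicalPhysics.QuantumFieldTheory.Balaban1983to89.B9SectBCodedChainOnSubfamily (gpFrame₂CodedOn)
open Literature.MathematicalPhysics.QuantumFieldTheory.Balaban1983to89.B9SectBCodedChainGlob (KSC₂ sectBStepPrinted_on_of_KSC₂_C37Y)
open Literature.MathematicalPhysics.QuantumFieldTheory.Balaban1983to89.Node00 (SiteY BlkY IBondY CfgY SiteParY parSymY deltaPrimeAY kernelFamilyS GpY)

variable {d ℓ : ℕ} {hd : 1 ≤ d + 1} {hL : Odd (ℓ + 1) ∧ 1 < ℓ + 1} {b₀ b₁ : ℝ} {Mstar : ℕ}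
variable {𝔸 : Type} [NormedRing 𝔸] [NormedAlgebra ℂ 𝔸] [CompleteSpace 𝔸]

/-! ## §1 The two analyticity predicates and the transport `hAn` -/

section Predicates

variable (G : Subgroup 𝔸ˣ) (x : MemberY d ℓ hd hL b₀ b₁ Mstar) (par : SiteParY 𝔸 x.toKIdx) {ι : Type} [Fintype ι] (b : Module.Basis ι ℝ 𝔸)
  (C37 C38 : ℝ → CfgY 𝔸 x.toKIdx → AfldY 𝔸 x.toKIdx → Prop)

/-- **THE CODED ANALYTICITY PREDICATE** (kernel-family independent): at a base `U` and exponent `α`, for every code `a` with `C37 α U a` the letters satisfy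
`Δp(prod U a)·Gop(prod U a) = 1 = Gop(prod U a)·Δp(prod U a)` — the hypothesis of `AnFrame₂.writeAn`, verbatim; `True` off the bases.
[cite: Balaban1985BackgroundPropagators, Thm 3.4 p.400, (3.62)–(3.64) p.402] -/
def IsAnKY : B9.KernelFamily (geo9Y x) (codingYx G x C37 C38).bg → (codingYx G x C37 C38).bg.Cfg → ℝ → Prop :=
  fun _ c α => match c with
    | .base U => ∀ a : AfldY 𝔸 x.toKIdx, C37 α U a →
        ΔpC x.toKIdx par b (.prod U a) * GopC x.toKIdx par b (.prod U a) = 1 ∧ GopC x.toKIdx par b (.prod U a) * ΔpC x.toKIdx par b (.prod U a) = 1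
    | .mult _ => True
    | .prod _ _ => True

/-- **THE RECORD-SIDE ANALYTICITY PREDICATE THE CODED ONE TRANSPORTS TO** (kernel-family independent; rescaling `r` of the exponent as in
`sectBStepPrinted_of_coded`): at `U` and exponent `β`, for every code `a` of the class at `r·β`, `η²G′(e^{ηa}U)` is the two-sided inverse of `η⁻²Δ′_a(e^{ηa}U)` in
the real coordinates of `b`. [cite: Balaban1985BackgroundPropagators, Thm 3.4 p.400 («extend to configurations U′U … as analytic functions of A′»), (3.62)–(3.64) p.402] -/
def IsAnRecY (r : ℝ) : B9.KernelFamily (geo9Y x) (bg9Y 𝔸 G x) → (bg9Y 𝔸 G x).Cfg → ℝ → Prop :=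
  fun _ U β' => ∀ a : AfldY 𝔸 x.toKIdx, C37 (r * β') U a →
    ΔpC x.toKIdx par b (.prod U a) * GopC x.toKIdx par b (.prod U a) = 1 ∧ GopC x.toKIdx par b (.prod U a) * ΔpC x.toKIdx par b (.prod U a) = 1

/-- the coded predicate at a base, unfolded. [cite: Balaban1985BackgroundPropagators, Thm 3.4 p.400, bookkeeping] -/
theorem isAnKY_base_iff (K : B9.KernelFamily (geo9Y x) (codingYx G x C37 C38).bg) (U : CfgY 𝔸 x.toKIdx) (α : ℝ) :
    IsAnKY G x par b C37 C38 K (.base U) α ↔ ∀ a : AfldY 𝔸 x.toKIdx, C37 α U a →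
      ΔpC x.toKIdx par b (.prod U a) * GopC x.toKIdx par b (.prod U a) = 1 ∧ GopC x.toKIdx par b (.prod U a) * ΔpC x.toKIdx par b (.prod U a) = 1 :=
  Iff.rfl

/-- ★ **THE TRANSPORT `hAn` HOLDS FOR THE PAIR `(IsAnKY, IsAnRecY r)`**, for every kernel family on either side (both predicates ignore it): at a base by
`pullAn_base_iff` and `r·(α/r) = α`, off the bases `pullAn` is `True`. [cite: Balaban1985BackgroundPropagators, Thm 3.4 p.400, bookkeeping] -/
theorem hAn_of_pin {r : ℝ} (hr : 0 < r) (K : B9.KernelFamily (geo9Y x) (codingYx G x C37 C38).bg) (Krec : B9.KernelFamily (geo9Y x) (bg9Y 𝔸 G x))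
    (c : (codingYx G x C37 C38).bg.Cfg) (α : ℝ) :
    IsAnKY G x par b C37 C38 K c α → pullAn (codingYx G x C37 C38) r (IsAnRecY G x par b C37 r) (pullK (codingYx G x C37 C38) Krec) c α := by
  intro h
  cases c with
  | base U =>
    rw [pullAn_base_iff]
    intro a ha
    rw [mul_div_cancel₀ α hr.ne'] at ha
    exact h a ha
  | mult a => trivial
  | prod U a => trivial

end Predicates

/-! ## §2 ★ The frame `AnFrame₂` over the coded carriers of a subfamily, inhabited -/

section Frame

variable [NormOneClass 𝔸] {J : Type} (f : J → MemberY d ℓ hd hL b₀ b₁ Mstar)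
  (c35 : ℝ) (G : Subgroup 𝔸ˣ) {ι : Type} [Fintype ι] [DecidableEq ι] (b : Module.Basis ι ℝ 𝔸)
  [∀ x : MemberY d ℓ hd hL b₀ b₁ Mstar, Fintype (geo9Y x).Site] [instDS : ∀ x : MemberY d ℓ hd hL b₀ b₁ Mstar, DecidableEq (geo9Y x).Site]
  [∀ x : MemberY d ℓ hd hL b₀ b₁ Mstar, Nonempty (geo9Y x).Site]
  (C37 C38 : ∀ j : J, ℝ → CfgY 𝔸 (f j).toKIdx → AfldY 𝔸 (f j).toKIdx → Prop)
  (par : ∀ j : J, SiteParY 𝔸 (f j).toKIdx)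
  (ιB : ∀ j : J, BlkY (f j).toKIdx → IBondY (f j).toKIdx)
  (KC : ∀ j : J, B9.KernelFamily (geo9Y (f j)) (codingYx G (f j) (C37 j) (C38 j)).bg)

/-- ★ **THE ANALYTIC-EXTENSION FRAME `AnFrame₂` OVER THE CODED CARRIERS OF A SUBFAMILY, INHABITED** at the coded predicate `IsAnKY`: the root frame
`gpFrame₂CodedOn` (any coded family `KC` with its (3.42) dictionaries displayed) plus `writeAn`, which holds BY DEFINITION of `IsAnKY` (the class (3.37) of the
coding at a base is `C37` at the multipliers, `bg_Cplx337_base_mult`; the coded product is `prod U a`). [cite: Balaban1985BackgroundPropagators, Thm 3.4 p.400, (3.62)–(3.64) p.402, (3.35)–(3.37) p.396; Balaban1984PropagatorsII, Lemma 2.1 p.234] -/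
noncomputable def anFrame₂CodedOn (hι : ∀ (j : J) (s : BlkY (f j).toKIdx), β (f j).toKIdx.hN (f j).toKIdx.D (f j).toKIdx.hk (ιB j s) = s)
    (hG1 : ∀ u : 𝔸ˣ, u ∈ G → ‖(u : 𝔸)‖ ≤ 1) (hpar : ∀ j (U : CfgY 𝔸 (f j).toKIdx), GVal G (f j).toKIdx U → ∀ z w, par j U z w ∈ G)
    (hunit : ∀ j (U : CfgY 𝔸 (f j).toKIdx), GVal G (f j).toKIdx U → IsUnit (deltaPrimeAY (f j).toKIdx (par j) U))
    (dB : ℕ) (M₂ : ℝ) (hM₂ : 0 ≤ M₂) (hrepr : ∀ (v : 𝔸) (j : ι), |b.repr v j| ≤ M₂ * ‖v‖)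
    (Cq : ℝ) (hCq : 0 ≤ Cq) (hC37 : ∀ j β' U a, C37 j β' U a → GVal G (f j).toKIdx U ∧ CplxLettersY G (f j) (par j) (ιB j) Cq β' U a)
    (cR : ℝ) (hcR : 0 < cR) (wBf : ℝ → ℝ → ℝ) (hwBf : ∀ B δ : ℝ, 0 ≤ B → 0 < δ → 0 < wBf B δ) (wδf : ℝ → ℝ) (hwδf : ∀ δ : ℝ, 0 < δ → 0 < wδf δ)
    (MInv aInv aW : ℝ) (hMInv : 0 < MInv) (haInv : 0 < aInv) (haW : 0 < aW)
    (hread : ∀ j, Read342Y G (f j) (par j) b (ιB j) (C37 j) (C38 j) (KC j) c35 cR MInv aInv 0 True)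
    (hwrite : ∀ j, Write342Y G (f j) (par j) b (ιB j) (C37 j) (C38 j) (KC j) wBf wδf aW 0 True) :
    AnFrame₂ c35 (fun j => geo9Y (f j)) (fun j => (codingYx G (f j) (C37 j) (C38 j)).bg) KC b (Fin (d + 1)) (fun j => SiteY (f j).toKIdx)
      (fun j => IsAnKY G (f j) (par j) b (C37 j) (C38 j)) :=
  { gpFrame₂CodedOn f c35 G b C37 C38 par ιB KC hι hG1 hpar hunit dB M₂ hM₂ hrepr Cq hCq hC37 cR hcR wBf hwBf wδf hwδf MInv aInv aW hMInv haInv haW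
      hread hwrite with
    writeAn := fun j α₀ c α₁ _ _ _ hreg _ _ H => by
      obtain ⟨U, rfl, -⟩ := (codingYx G (f j) (C37 j) (C38 j)).exists_of_bg_Reg335 hreg
      intro a ha
      exact H (.mult a) (((codingYx G (f j) (C37 j) (C38 j)).bg_Cplx337_base_mult α₁ U a).2 ha) }

end Frame

/-! ## §3 ★★★ The chain with `hAn` discharged (pin `IsAnRecY L⁴`) -/

section Chain

variable [NormOneClass 𝔸] [FiniteDimensional ℝ 𝔸] {J : Type} (f : J → MemberY d ℓ hd hL b₀ b₁ Mstar) [∀ x : MemberY d ℓ hd hL b₀ b₁ Mstar, Fintype (geo9Y x).Site]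
  (G : Subgroup 𝔸ˣ) {ι : Type} [Fintype ι] (b : Module.Basis ι ℝ 𝔸)
  (ιB : ∀ j : J, BlkY (f j).toKIdx → IBondY (f j).toKIdx)
  (C38 : ∀ j : J, ℝ → CfgY 𝔸 (f j).toKIdx → AfldY 𝔸 (f j).toKIdx → Prop)

/-- ★★★ **THE CODED-CARRIER CHAIN (`KSC₂`, class `C37Y`) ON A SUBFAMILY WITH SECTIONS, `hAn` DISCHARGED**: analyticity predicates `IsAnKY` (coded) and
`IsAnRecY L⁴` (record).  IF the Sect.-B step holds for `(KSC₂, pullK GA, pullS Cinv, IsAnKY)` over the coded carriers on `J` — the letters-level frames' output —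
THEN it holds for the record's `(G′ read by kernelFamilyS (GpY parSymY) parSymY, GA, Cinv, IsAnRecY L⁴)` on `J`; displayed besides: `hι`, `hG1`, the basis data,
nonnegative Hölder members of `GA`, `C38`, `ac`. [cite: Balaban1985BackgroundPropagators, Thm 3.4 p.400, Sect. B pp.400–407, (3.35)–(3.37) p.396, (3.47) p.398, (3.62)–(3.64) p.402; Balaban1984PropagatorsII, Lemma 2.1 p.234] -/
theorem sectBStepPrinted_on_of_KSC₂_C37Y_an (hι : ∀ (j : J) (s : BlkY (f j).toKIdx), β (f j).toKIdx.hN (f j).toKIdx.D (f j).toKIdx.hk (ιB j s) = s)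
    (hG1 : ∀ u : 𝔸ˣ, u ∈ G → ‖(u : 𝔸)‖ ≤ 1) {M₂ : ℝ} (hM₂ : 0 ≤ M₂) (hrepr : ∀ (v : 𝔸) (j : ι), |b.repr v j| ≤ M₂ * ‖v‖) (c35 : ℝ) (dC : ℕ)
    (GA : ∀ j : J, B9.KernelFamily (geo9Y (f j)) (bg9Y 𝔸 G (f j))) (Cinv : ∀ j : J, B9.SiteKernel (geo9Y (f j)) (bg9Y 𝔸 G (f j)))
    (hGA : ∀ (j : J) (U : (bg9Y 𝔸 G (f j)).Cfg),
      (∀ lam β' ζ, 0 ≤ (GA j).h1 U lam β' ζ) ∧ (∀ lam y, 0 ≤ (GA j).e4 U lam y) ∧ (∀ lam β' ζ, 0 ≤ (GA j).h2 U lam β' ζ))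
    {ac : ℝ} (hac : 0 < ac)
    (h : B9.SectBStepPrinted dC c35 (fun j => geo9Y (f j))
      (fun j => (codingYx G (f j) (C37Y G (f j) (ιB j) (4 * ((d : ℝ) + 1) * Real.exp (3 * (((d : ℝ) + 1) / 2)))) (C38 j)).bg)
      (fun j => KSC₂ G (f j) (parSymY (f j).toKIdx) (C37Y G (f j) (ιB j) (4 * ((d : ℝ) + 1) * Real.exp (3 * (((d : ℝ) + 1) / 2)))) (C38 j))
      (fun j => pullK (codingYx G (f j) (C37Y G (f j) (ιB j) (4 * ((d : ℝ) + 1) * Real.exp (3 * (((d : ℝ) + 1) / 2)))) (C38 j)) (GA j))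
      (fun j => pullS (codingYx G (f j) (C37Y G (f j) (ιB j) (4 * ((d : ℝ) + 1) * Real.exp (3 * (((d : ℝ) + 1) / 2)))) (C38 j)) (Cinv j))
      (fun j => IsAnKY G (f j) (parSymY (f j).toKIdx) b (C37Y G (f j) (ιB j) (4 * ((d : ℝ) + 1) * Real.exp (3 * (((d : ℝ) + 1) / 2)))) (C38 j))) :
    B9.SectBStepPrinted dC c35 (fun j => geo9Y (f j)) (fun j => bg9Y 𝔸 G (f j))
      (fun j => kernelFamilyS (f j).toKIdx (bg9Y 𝔸 G (f j)) (fun U => U) (GpY (f j).toKIdx (parSymY (f j).toKIdx)) (parSymY (f j).toKIdx)) GA Cinv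
      (fun j => IsAnRecY G (f j) (parSymY (f j).toKIdx) b (C37Y G (f j) (ιB j) (4 * ((d : ℝ) + 1) * Real.exp (3 * (((d : ℝ) + 1) / 2)))) (((ℓ : ℝ) + 1) ^ 4)) := by
  have hL4 : (0 : ℝ) < ((ℓ : ℝ) + 1) ^ 4 := by positivity
  refine sectBStepPrinted_on_of_KSC₂_C37Y f G b ιB C38 hι hG1 hM₂ hrepr c35 dC GA Cinv hGA _ _ hac (fun j c α => ⟨?_, ?_⟩) h
  · exact hAn_of_pin G (f j) (parSymY (f j).toKIdx) b _ (C38 j) hL4 _ _ c α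
  · exact hAn_of_pin G (f j) (parSymY (f j).toKIdx) b _ (C38 j) hL4 _ _ c α

/-- ★★★ **THE SAME ON A CORNER-FREE SUBFAMILY** (`hf : β` onto at every `f j`; sections `Function.surjInv (hf j)`): the displayed hypotheses are the frames' output
`h` and structural record data ONLY. [cite: Balaban1985BackgroundPropagators, Thm 3.4 p.400, Sect. B pp.400–407, (3.35)–(3.37) p.396, p.399; Balaban1984PropagatorsII, (2.45) p.231] -/
theorem sectBStepPrinted_cornerFree_of_KSC₂_C37Y_an (hf : ∀ j : J, Function.Surjective (β (f j).toKIdx.hN (f j).toKIdx.D (f j).toKIdx.hk))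
    (hG1 : ∀ u : 𝔸ˣ, u ∈ G → ‖(u : 𝔸)‖ ≤ 1) {M₂ : ℝ} (hM₂ : 0 ≤ M₂) (hrepr : ∀ (v : 𝔸) (j : ι), |b.repr v j| ≤ M₂ * ‖v‖) (c35 : ℝ) (dC : ℕ)
    (GA : ∀ j : J, B9.KernelFamily (geo9Y (f j)) (bg9Y 𝔸 G (f j))) (Cinv : ∀ j : J, B9.SiteKernel (geo9Y (f j)) (bg9Y 𝔸 G (f j)))
    (hGA : ∀ (j : J) (U : (bg9Y 𝔸 G (f j)).Cfg),
      (∀ lam β' ζ, 0 ≤ (GA j).h1 U lam β' ζ) ∧ (∀ lam y, 0 ≤ (GA j).e4 U lam y) ∧ (∀ lam β' ζ, 0 ≤ (GA j).h2 U lam β' ζ))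
    {ac : ℝ} (hac : 0 < ac)
    (h : B9.SectBStepPrinted dC c35 (fun j => geo9Y (f j))
      (fun j => (codingYx G (f j) (C37Y G (f j) (fun s => Function.surjInv (hf j) s) (4 * ((d : ℝ) + 1) * Real.exp (3 * (((d : ℝ) + 1) / 2)))) (C38 j)).bg)
      (fun j => KSC₂ G (f j) (parSymY (f j).toKIdx)
        (C37Y G (f j) (fun s => Function.surjInv (hf j) s) (4 * ((d : ℝ) + 1) * Real.exp (3 * (((d : ℝ) + 1) / 2)))) (C38 j))
      (fun j => pullK (codingYx G (f j) (C37Y G (f j) (fun s => Function.surjInv (hf j) s) (4 * ((d : ℝ) + 1) * Real.exp (3 * (((d : ℝ) + 1) / 2))))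
        (C38 j)) (GA j))
      (fun j => pullS (codingYx G (f j) (C37Y G (f j) (fun s => Function.surjInv (hf j) s) (4 * ((d : ℝ) + 1) * Real.exp (3 * (((d : ℝ) + 1) / 2))))
        (C38 j)) (Cinv j))
      (fun j => IsAnKY G (f j) (parSymY (f j).toKIdx) b
        (C37Y G (f j) (fun s => Function.surjInv (hf j) s) (4 * ((d : ℝ) + 1) * Real.exp (3 * (((d : ℝ) + 1) / 2)))) (C38 j))) :
    B9.SectBStepPrinted dC c35 (fun j => geo9Y (f j)) (fun j => bg9Y 𝔸 G (f j))
      (fun j => kernelFamilyS (f j).toKIdx (bg9Y 𝔸 G (f j)) (fun U => U) (GpY (f j).toKIdx (parSymY (f j).toKIdx)) (parSymY (f j).toKIdx)) GA Cinv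
      (fun j => IsAnRecY G (f j) (parSymY (f j).toKIdx) b
        (C37Y G (f j) (fun s => Function.surjInv (hf j) s) (4 * ((d : ℝ) + 1) * Real.exp (3 * (((d : ℝ) + 1) / 2)))) (((ℓ : ℝ) + 1) ^ 4)) :=
  sectBStepPrinted_on_of_KSC₂_C37Y_an f G b (fun j s => Function.surjInv (hf j) s) C38 (fun j s => Function.surjInv_eq (hf j) s) hG1 hM₂ hrepr c35 dC GA Cinv
    hGA hac h

end Chain

/-! ## §4 The record pin in NODE 00's vocabulary -/

section Pin

variable (G : Subgroup 𝔸ˣ) (x : MemberY d ℓ hd hL b₀ b₁ Mstar) (par : SiteParY 𝔸 x.toKIdx) {ι : Type} [Fintype ι] (b : Module.Basis ι ℝ 𝔸)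
  (C37 : ℝ → CfgY 𝔸 x.toKIdx → AfldY 𝔸 x.toKIdx → Prop)

/-- **THE PIN READ BACK: `Δ′_a(e^{ηa}U)` IS A UNIT** for every code `a` of the class at `r·β`, whenever `IsAnRecY r … U β` — the two-sided inverse identities in
coordinates are those of `η⁻²Δ′_a` and `η²G′` as `ℂ`-linear maps (`conj b` and `restrictScalars` are injective and multiplicative).
[cite: Balaban1985BackgroundPropagators, Thm 3.4 p.400, Thm 3.11 p.416 (Δ′ invertible), bookkeeping] -/
theorem isUnit_deltaPrimeAY_of_isAnRecY {r β' : ℝ} (K : B9.KernelFamily (geo9Y x) (bg9Y 𝔸 G x)) {U : CfgY 𝔸 x.toKIdx}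
    (h : IsAnRecY G x par b C37 r K U β') {a : AfldY 𝔸 x.toKIdx} (ha : C37 (r * β') U a) :
    IsUnit (deltaPrimeAY x.toKIdx par (mulY x.toKIdx (fluct (kGeo x.toKIdx).eta a) U)) := by
  obtain ⟨h1, h2⟩ := h a ha
  set W := mulY x.toKIdx (fluct (kGeo x.toKIdx).eta a) U with hW
  set η := (kGeo x.toKIdx).eta with hη
  have hη0 : η ≠ 0 := by rw [hη]; show |x.cf|⁻¹ ≠ 0; exact inv_ne_zero (abs_ne_zero.2 x.hcf)
  have hη2 : (η ^ 2 : ℝ) ≠ 0 := pow_ne_zero 2 hη0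
  -- the letters at the coded product are the conjugates of the scaled operators at `W`
  have hΔ : ΔpC x.toKIdx par b (.prod U a) = conj b ((η ^ 2)⁻¹ • (deltaPrimeAY x.toKIdx par W).restrictScalars ℝ) := rfl
  have hG : GopC x.toKIdx par b (.prod U a) = conj b ((η ^ 2) • (GpY x.toKIdx par W).restrictScalars ℝ) := rfl
  rw [hΔ, hG, ← B9Eq352DivFormLetters.conj_mul, smul_mul_smul_comm, inv_mul_cancel₀ hη2, one_smul] at h1
  rw [hΔ, hG, ← B9Eq352DivFormLetters.conj_mul, smul_mul_smul_comm, mul_inv_cancel₀ hη2, one_smul] at h2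
  have hinj : Function.Injective (conj (S := SiteY x.toKIdx) b) := fun T₁ T₂ hT => (B9Eq352DivFormLetters.coordEquiv b).conj.injective hT
  have hone : conj (S := SiteY x.toKIdx) b (1 : Module.End ℝ (SiteY x.toKIdx → 𝔸)) = 1 := by
    show (B9Eq352DivFormLetters.coordEquiv b).conj LinearMap.id = LinearMap.id
    exact LinearEquiv.conj_id _
  rw [← hone] at h1 h2
  have h1' := hinj h1
  have h2' := hinj h2
  -- restrict scalars: the identities hold for the ℂ-linear operators
  have hr : ∀ (A Bm : (SiteY x.toKIdx → 𝔸) →ₗ[ℂ] (SiteY x.toKIdx → 𝔸)), A.restrictScalars ℝ * Bm.restrictScalars ℝ = 1 → A * Bm = 1 := by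
    intro A Bm hAB
    apply LinearMap.restrictScalars_injective ℝ
    rw [Module.End.mul_eq_comp, LinearMap.restrictScalars_comp] -- (A ∘ B).restrict = A.restrict ∘ B.restrict
    rw [Module.End.mul_eq_comp] at hAB
    rw [hAB]
    rfl
  exact ⟨⟨deltaPrimeAY x.toKIdx par W, GpY x.toKIdx par W, hr _ _ h1', hr _ _ h2'⟩, rfl⟩

end Pin

end Literature.MathematicalPhysics.QuantumFieldTheory.Balaban1983to89.B9SectBCodedChainAn
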